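import Literature.NumberTheory.EllipticCurves.DivisionPolynomialFormalMulProofs
import Literature.NumberTheory.EllipticCurves.PadicSigma
import HarnessLib

/-!
# Mazur–Tate 1991 Thm. 3.1 AT `p = 2` in the form printed by Silverman (Math. Ann. 332, 2005, §5
# Remark 2): at a good ordinary `2` the SQUARED sigma function `σ² ∈ z² + z³ℤ₂⟦z⟧` exists uniquely,
# characterised by the division polynomials — ONE named fact

Topic `Literature/NumberTheory/EllipticCurves` (trunk T-NT-EC); sibling of `PadicSigma.lean`
(`mazur_tate_sigma_existsUnique`, MST 2006 Thm. 1.3, `p ≥ 5`), `PadicSigmaOddPrime.lean`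
(`mazur_tate_sigma_exists_odd`, `p = 3`) and `PadicSigmaSq.lean` (the sigma-squared receptacle
`IsMazurTateSigmaSqPair` / `canonicalPAdicHeightSq` / `IsCanonicalSq`). ONE named fact (`def … : Prop`,
cited, nothing proved; net literature debt +1, DECLARED) plus the definitions needed to state it
verbatim and small proved unfolding lemmas. Typer seat `bsd-goldfeld-ty` g8 of the cell `bsd-goldfeld`
(memo `TY-HYPOTHESES-AT-TWO.md` §10.4 row R1), in support of stmt-BirchSwinnertonDyer-19141 (LTYZ 2025
Thm. 1.1 at `p = 2`): this is the ONE printed `p = 2` statement about the Mazur–Tate sigma function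
(see `CanonicalPAdicHeightTwoJunkProofs.lean` for why the tree's `σ`-vocabulary is void at `2`).

## Citation header

J. H. Silverman, *`p`-adic properties of division polynomials and elliptic divisibility sequences*,
Math. Ann. 332 (2005) 443–471, doi:10.1007/s00208-004-0608-0 = arXiv math/0404412 [Silverman2005DivPoly]
(REFEREED; READ 2026-08-27 on the arXiv text `paper:arxiv-math-0404412`, chunks p0004 §1 Def. 1,
p0010–p0011 §5). B. Mazur, J. Tate, *The `p`-adic sigma function*, Duke Math. J. 62 (1991) 663–688,
§2 and Thm. 3.1 [MazurTate1991] — the PROVING source, to which Silverman attributes the construction;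
NOT held on the hub (acquisition acq-00916, cite-only; `lit reconstruct` verdict «statement-only» via
Silverman 2005). Per the secondary-source rule both are cited; the statement is transcribed from the
secondary.

**Setting, verbatim** (§5, p0010): «K a finite extension of `ℚ_p`. `R` the ring of integers of `K`.
… `E/K` an elliptic curve over `K`. We also fix a minimal Weierstrass equation for `E/K`, from which we
obtain an invariant differential `ω = dx/(2y+a₁x+a₃)` and a uniformizer `z = −x/y` at `𝒪` satisfying
`(ω/dz)(𝒪) = 1`. `𝓔/R` the Néron model of `E`. `𝓔^f` the formal group of `𝓔`. `F_n` the `n`-division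
polynomial on `E`, that is, the rational function `F_n ∈ K(E)` satisfying Definition 1», Definition 1
(§1, p0004): «`(F_n) = [n]^*(𝒪) − n²(𝒪)` and `(z^{n²}F_n/[n](z))(𝒪) = 1`. If `n ≠ 0` in `K`, then …
the normalization condition becomes simply `(z^{n²−1}F_n)(𝒪) = n`.»

**Theorem 11 (Mazur–Tate), verbatim** (p0010–p0011): «With the above notation and normalizations,
assume that `p ≥ 3` and that `𝓔` has good ordinary reduction. Then there is a unique power series
`σ ∈ z + z²R⟦z⟧` satisfying `σ(nQ) = σ(Q)^{n²}F_n(Q)` for all `Q ∈ 𝓔^f(R̄)`. (18)» «Proof. See [12,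
Section 2] for the construction of `σ` and [12, Theorem 3.1] for a description of its properties. The
construction of `σ` actually works as long as `𝓔` has ordinary reduction …»

**Remark 2, verbatim** (p0011 L7): «Theorem 11 remains true for `p = 2` provided that everything is
squared. That is, there is a unique power series `σ² ∈ z² + z³R⟦z⟧` satisfying
`σ²(nQ) = σ(Q)^{2n²}F_n²(Q)`. But it is not possible to unambiguously take a square root and have (18)
hold for all `n ≥ 1` and all `Q ∈ 𝓔^f(R̄)`.»

## Transcription

* `K = ℚ₂`, `R = ℤ₂` (the case the cell needs: `E/ℚ` with good ordinary reduction at `2`, base-changed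
  to `ℚ₂`); a GLOBALLY minimal `W/ℚ` is minimal at `2`, so `W ⊗ ℚ₂` is «a minimal Weierstrass equation»
  with its own `ω`, `z = −x/y` (the tree's `formalOmega`, parameter `t`; `(ω/dz)(𝒪) = 1` holds for every
  Weierstrass equation, AEC IV.1). «good ordinary reduction» at `2` = `W.HasGoodReductionAtPrime 2 ∧
  ¬ 2 ∣ a₂(W)` (`frobeniusTrace`), the dictionary of `mazur_tate_sigma_existsUnique`.
  -- TODO(general form): `K/ℚ_p` finite, `E/K` with a `K`-minimal equation (no `ℚ`-structure).
* `F_n² = ψₙ²(x, y) = ΨSqₙ(x)` — Mathlib's univariate `WeierstrassCurve.ΨSq n ∈ R[x]`: `F_n` and `ψₙ`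
  have the same divisor `[n]^*(𝒪) − n²(𝒪)` and leading terms `±n z^{1−n²}` at `𝒪` (AEC Ex. 3.7;
  `ψₙ = n x^{(n²−1)/2} + ⋯` for odd `n`, `ψₙ = (n/2)ψ₂ x^{(n²−4)/2} + ⋯`, `ψ₂ = 2y + a₁x + a₃ = −2z^{−3} + ⋯`
  for even `n`), so `F_n = ±ψₙ` and the SQUARES agree — precisely the sign that Remark 2 says cannot be
  fixed is squared away.
* «`σ²(nQ) = σ²(Q)^{n²}F_n²(Q)` for all `Q ∈ 𝓔^f(R̄)`» ⟺ the identity of power series in `z`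
  obtained by clearing the pole of `F_n²` of order `2(n² − 1)`: with `u = z²x(z)` (`formalXMulSq`) and
  `Pₙ(z) := z^{2(n²−1)}ΨSqₙ(x(z)) = Σ_{i < n²} ΨSqₙ[i] uⁱ z^{2(n²−1−i)} ∈ R⟦z⟧` (the very sum of the
  tree's `sum_ΨSq_mul_formalXMulSq_subst_formalMul`, `deg ΨSqₙ ≤ n² − 1`),
  **`z^{2(n²−1)} · Σ([n](z)) = Σ(z)^{n²} · Pₙ(z)`** (`SigmaSqDivisionIdentity`; `[n](z) = formalMul n`).
  Both sides are series with coefficients in `R` converging on the open unit disc of `ℂ₂`, and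
  `{z(Q) : Q ∈ 𝓔^f(R̄)}` is that disc's set of `R̄`-points (infinite, accumulating at `0`), so the
  pointwise statement for all `Q` and the identity of series are EQUIVALENT (identity theorem /
  uniqueness of coefficients, the move the tree makes in `DivisionPolynomialFormalMulProofs`).
* «`σ² ∈ z² + z³R⟦z⟧`» = `[z⁰]Σ = [z¹]Σ = 0`, `[z²]Σ = 1`, every coefficient in `ℤ₂`
  (`IsSigmaSqDivisionSeries`, conjoined with the identities for all `n ≥ 1`); «unique» = `∃!`.

## Relation to the sigma-squared receptacle (`PadicSigmaSq.lean`) — what is NOT claimed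

`IsMazurTateSigmaSqPair` there characterises `Σ` by the Mazur–Stein–Tate DIFFERENTIAL EQUATION
(squared) + evenness + integrality; the present fact characterises `Σ` by DIVISION POLYNOMIALS, as
printed. That the two characterisations single out the same series is the content of Mazur–Tate 1991
§§2–3 / Thm. 3.1 (for odd `p` it is how MST 2006 Thm. 1.3 quotes MT91); it is NOT asserted here and
not proved in the tree (at odd `p` the tree proves the formal theta relation of an ODE pair,
`thetaLHS_eq_thetaRHS`, from which the division identities follow by induction — successor work,
memo §10.4 R1). Nothing here mentions heights.

## What is here

* `WeierstrassCurve.sigmaSqDivisionRHS V n = Pₙ` (the pole-cleared `z^{2(n²−1)}ψₙ²(x(z))`),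
  `WeierstrassCurve.SigmaSqDivisionIdentity V Sq n`, `WeierstrassCurve.IsSigmaSqDivisionSeries V Sq`
  (any `p`, any Weierstrass equation over `ℚ_p`);
* the named fact `mazurTate_sigmaSq_existsUnique_two` (nothing asserted; consumers take
  `(h : mazurTate_sigmaSq_existsUnique_two)`);
* PROVED unfolding / sanity lemmas: `sigmaSqDivisionRHS_one` (`P₁ = 1`),
  `sigmaSqDivisionIdentity_one` (the `n = 1` identity holds for every `Sq`),
  `IsSigmaSqDivisionSeries.isPadicInt`, and the unpacker `exists_isSigmaSqDivisionSeries_two`.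
-/

noncomputable section

open scoped Classical
open PowerSeries Polynomial Literature.NumberTheory.EllipticCurves

namespace WeierstrassCurve

section AnyPrime

variable {p : ℕ} [Fact p.Prime] (V : WeierstrassCurve ℚ_[p])

/-- **`Pₙ(z) = z^{2(n²−1)} ψₙ²(x(z)) = Σ_{i < n²} ΨSqₙ[i] · uⁱ · z^{2(n²−1−i)} ∈ ℚ_p⟦z⟧`** (`u = z²x(z)`,
`ΨSqₙ = ψₙ² ∈ R[x]` Mathlib's squared division polynomial, `deg ΨSqₙ ≤ n² − 1`): the squared `n`-division
polynomial `F_n² = ψₙ²` as a function on the formal group, with its pole of order `2(n²−1)` at `𝒪`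
cleared. The sum is literally the one of the tree's `sum_ΨSq_mul_formalXMulSq_subst_formalMul`.
[Silverman 2005, §1 Def. 1 and §5 (18); Silverman AEC Ex. 3.7(d)] [cite: Silverman2005DivPoly, §1 Def. 1]
[cite: SilvermanAEC2009, Exercise 3.7] -/
def sigmaSqDivisionRHS (n : ℕ) : ℚ_[p]⟦X⟧ :=
  ∑ i ∈ Finset.range (n ^ 2),
    PowerSeries.C ((V.ΨSq n).coeff i) * V.formalXMulSq ^ i * PowerSeries.X ^ (2 * (n ^ 2 - 1 - i))

/-- **The squared `n`-division identity for a series `Σ`**: «`σ²(nQ) = σ²(Q)^{n²}F_n²(Q)` for all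
`Q ∈ 𝓔^f(R̄)`» (Silverman 2005 §5 Rem. 2, the square of Thm. 11 (18)), as the identity of power series
`z^{2(n²−1)} · Σ([n](z)) = Σ(z)^{n²} · Pₙ(z)` (`[n] = formalMul n`, `Pₙ = sigmaSqDivisionRHS n`; the
pointwise and the series forms are equivalent, see the module docstring).
[cite: Silverman2005DivPoly, §5 Thm. 11 (18) and Rem. 2] -/
def SigmaSqDivisionIdentity (Sq : ℚ_[p]⟦X⟧) (n : ℕ) : Prop :=
  PowerSeries.X ^ (2 * (n ^ 2 - 1)) * Sq.subst (V.formalMul n) = Sq ^ (n ^ 2) * V.sigmaSqDivisionRHS n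

/-- **«a power series `σ² ∈ z² + z³R⟦z⟧` satisfying `σ²(nQ) = σ(Q)^{2n²}F_n²(Q)`» for all `n ≥ 1`**
(`R = ℤ_p`): `[z⁰]Σ = [z¹]Σ = 0`, `[z²]Σ = 1`, all coefficients in `ℤ_p`, and the squared `n`-division
identity for every `n ≥ 1`. [cite: Silverman2005DivPoly, §5 Rem. 2] -/
def IsSigmaSqDivisionSeries (Sq : ℚ_[p]⟦X⟧) : Prop :=
  constantCoeff Sq = 0 ∧ coeff 1 Sq = 0 ∧ coeff 2 Sq = 1 ∧ (∀ k, ‖coeff k Sq‖ ≤ 1) ∧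
    ∀ n, 1 ≤ n → V.SigmaSqDivisionIdentity Sq n

/-! ### Unfolding and sanity lemmas (proved) -/

/-- `P₁ = 1` (`ΨSq₁ = 1`). [cite: Silverman2005DivPoly, §1 Def. 1] -/
theorem sigmaSqDivisionRHS_one : V.sigmaSqDivisionRHS 1 = 1 := by
  simp [sigmaSqDivisionRHS, WeierstrassCurve.ΨSq_one]

/-- The `n = 1` identity `z⁰ · Σ([1](z)) = Σ¹ · P₁` holds for every `Σ` (`[1](z) = z`, `P₁ = 1`).
[cite: Silverman2005DivPoly, §5 Thm. 11 (18)] -/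
theorem sigmaSqDivisionIdentity_one (Sq : ℚ_[p]⟦X⟧) : V.SigmaSqDivisionIdentity Sq 1 := by
  rw [SigmaSqDivisionIdentity, formalMul_one, PowerSeries.X_subst, sigmaSqDivisionRHS_one]
  simp

variable {V} in
/-- A sigma-squared division series lies in `ℤ_p⟦z⟧`. [cite: Silverman2005DivPoly, §5 Rem. 2] -/
theorem IsSigmaSqDivisionSeries.isPadicInt {Sq : ℚ_[p]⟦X⟧} (h : V.IsSigmaSqDivisionSeries Sq) :
    IsPadicInt Sq :=
  isPadicInt_iff_coeff.mpr h.2.2.2.1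

variable {V} in
/-- Unpacking the normalisation `Σ = z² + O(z³)`. [cite: Silverman2005DivPoly, §5 Rem. 2] -/
theorem IsSigmaSqDivisionSeries.coeff_two_eq {Sq : ℚ_[p]⟦X⟧} (h : V.IsSigmaSqDivisionSeries Sq) :
    constantCoeff Sq = 0 ∧ coeff 1 Sq = 0 ∧ coeff 2 Sq = 1 :=
  ⟨h.1, h.2.1, h.2.2.1⟩

variable {V} in
/-- Unpacking the identities: for `n ≥ 1`, `z^{2(n²−1)}·Σ([n](z)) = Σ^{n²}·Pₙ`.
[cite: Silverman2005DivPoly, §5 Rem. 2] -/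
theorem IsSigmaSqDivisionSeries.identity {Sq : ℚ_[p]⟦X⟧} (h : V.IsSigmaSqDivisionSeries Sq) {n : ℕ}
    (hn : 1 ≤ n) : V.SigmaSqDivisionIdentity Sq n :=
  h.2.2.2.2 n hn

end AnyPrime

end WeierstrassCurve

namespace Literature.NumberTheory.EllipticCurves

open WeierstrassCurve

/-- **Mazur–Tate 1991, Thm. 3.1 at `p = 2`, as printed by Silverman, Math. Ann. 332 (2005), §5
Remark 2** (after Thm. 11 = MT91 Thm. 3.1 for `p ≥ 3`: «there is a unique power series
`σ ∈ z + z²R⟦z⟧` satisfying `σ(nQ) = σ(Q)^{n²}F_n(Q)` for all `Q ∈ 𝓔^f(R̄)`», for `E/K`, `K/ℚ_p` finite,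
with a minimal Weierstrass equation and good ordinary reduction): «Theorem 11 remains true for `p = 2`
provided that everything is squared. That is, there is a unique power series `σ² ∈ z² + z³R⟦z⟧`
satisfying `σ²(nQ) = σ(Q)^{2n²}F_n²(Q)`. But it is not possible to unambiguously take a square root and
have (18) hold for all `n ≥ 1` and all `Q ∈ 𝓔^f(R̄)`.» Transcription (module docstring): `K = ℚ₂`;
`W/ℚ` elliptic, GLOBALLY minimal (hence minimal at `2`), with good ORDINARY reduction at `2`
(`HasGoodReductionAtPrime 2`, `2 ∤ a₂ = frobeniusTrace W 2`); then there is EXACTLY ONE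
`Σ ∈ ℚ₂⟦z⟧` with `Σ = z² + O(z³)`, all coefficients in `ℤ₂`, satisfying for every `n ≥ 1` the squared
`n`-division identity `z^{2(n²−1)}Σ([n](z)) = Σ(z)^{n²}·z^{2(n²−1)}ψₙ²(x(z))` of `W ⊗ ℚ₂`
(`IsSigmaSqDivisionSeries`; `F_n² = ψₙ² = ΨSqₙ(x)`, the pointwise statement over `R̄` ⟺ the series
identity). SPECIAL CASE of the printed statement (`K = ℚ₂`, equation defined over `ℚ`); the proving
source is Mazur–Tate 1991 §2 / Thm. 3.1 (not held: acq-00916 cite-only), read through Silverman's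
refereed restatement. Nothing is asserted (D-0014); users take `(h : mazurTate_sigmaSq_existsUnique_two)`.
NOT claimed: that this `Σ` satisfies the differential-equation characterisation
`WeierstrassCurve.IsMazurTateSigmaSqPair` of `PadicSigmaSq.lean` (MT91's equivalence, successor work),
nor anything about heights.
-- TODO(general form): `E/K`, `K/ℚ_p` finite, `K`-minimal equation; odd `p` (Thm. 11 itself, the
-- division-polynomial twin of `WeierstrassCurve.mazur_tate_sigma_existsUnique`).
[cite: Silverman2005DivPoly, §5 Thm. 11 and Remark 2 (arXiv math/0404412 text chunks p0010–p0011)]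
[cite: MazurTate1991, §2 and Thm. 3.1] -/
def mazurTate_sigmaSq_existsUnique_two : Prop :=
  ∀ (W : WeierstrassCurve ℚ) [W.IsElliptic] [W.IsGloballyMinimal],
    W.HasGoodReductionAtPrime 2 → ¬ (2 : ℤ) ∣ W.frobeniusTrace 2 →
      ∃! Sq : ℚ_[2]⟦X⟧, (W.baseChange ℚ_[2]).IsSigmaSqDivisionSeries Sq

/-- Unpacker: under the fact, a globally minimal `W/ℚ` with good ordinary reduction at `2` has a
sigma-squared division series over `ℚ₂`. [cite: Silverman2005DivPoly, §5 Rem. 2] -/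
theorem exists_isSigmaSqDivisionSeries_two (h : mazurTate_sigmaSq_existsUnique_two)
    (W : WeierstrassCurve ℚ) [W.IsElliptic] [W.IsGloballyMinimal] (hgood : W.HasGoodReductionAtPrime 2)
    (hord : ¬ (2 : ℤ) ∣ W.frobeniusTrace 2) :
    ∃ Sq : ℚ_[2]⟦X⟧, (W.baseChange ℚ_[2]).IsSigmaSqDivisionSeries Sq :=
  (h W hgood hord).exists

/-- Uniqueness clause: two sigma-squared division series of `W ⊗ ℚ₂` coincide.
[cite: Silverman2005DivPoly, §5 Rem. 2] -/
theorem IsSigmaSqDivisionSeries.unique_two (h : mazurTate_sigmaSq_existsUnique_two)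
    (W : WeierstrassCurve ℚ) [W.IsElliptic] [W.IsGloballyMinimal] (hgood : W.HasGoodReductionAtPrime 2)
    (hord : ¬ (2 : ℤ) ∣ W.frobeniusTrace 2) {S₁ S₂ : ℚ_[2]⟦X⟧}
    (h₁ : (W.baseChange ℚ_[2]).IsSigmaSqDivisionSeries S₁)
    (h₂ : (W.baseChange ℚ_[2]).IsSigmaSqDivisionSeries S₂) : S₁ = S₂ :=
  (h W hgood hord).unique h₁ h₂

end Literature.NumberTheory.EllipticCurves
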